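import Literature.Topology.FourManifolds.ConnectedSumCohomology
import Literature.Topology.FourManifolds.ConnectedSumSummands
import Literature.Topology.FourManifolds.HomotopyS4CriterionHurewicz
import Literature.AlgebraicTopology.SingularHomology.MayerVietorisCriteria
import Literature.AlgebraicTopology.Homotopy.HomotopyGroupsGeneralPosition
import HarnessLib

/-!
# A summand of a homotopy 4-sphere is a homotopy 4-sphere — proofs (Kosinski 1993, VI Prop. 2.1)

Topic `Literature/Topology/FourManifolds`, proofs file for the named fact
`Literature.Topology.FourManifolds.nonempty_homotopyEquiv_sphere_four_left_of_isConnectedSum`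
(`HomotopySphereSummands.lean`; A. Kosinski, *Differential Manifolds* (1993), Ch. VI §2,
Prop. 2.1, "only if" half, `m = 4`): if `P` is a connected sum `M # N` of closed connected smooth
4-manifolds (`Literature.Topology.FourManifolds.IsConnectedSum (𝓡 4) (𝓡 4) (𝓡 4) M N P`) and
`P ≃ₕ S⁴`, then `M ≃ₕ S⁴`.

## What is proved

* `ConnectedSumNeck.isZero_csingularHomology_range_jA` — for the gluing data of a connected sum
  `P` of `(m+1)`-manifolds (`ConnectedSumNeck`, `HomotopySpheresSum.lean`) and `0 < j ≠ m`:
  `Hⱼ(P) = 0 ⟹ Hⱼ(range jA) = 0` (Mayer–Vietoris for the open cover `P = range jA ∪ range jB`,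
  whose intersection is the neck `ℝᵐ⁺¹ ∖ 0 ≃ Sᵐ`, `ConnectedSumNeck.neckHomeomorph`; the tree's
  criterion `isZero_csingularHomology_of_union_of_inter`).
* `isZero_singularHomology_succ_of_isZero_compl_singleton` — for a Hausdorff space `M` charted
  on `ℝᵐ⁺¹`, a point `p` and `0 < j ≠ m`: `Hⱼ₊₁(M ∖ {p}) = 0 ⟹ Hⱼ₊₁(M) = 0` (Mayer–Vietoris for
  `M = (M ∖ {p}) ∪ B`, `B ∋ p` a chart ball, `(M ∖ {p}) ∩ B ≃ Sᵐ` with `Hⱼ(Sᵐ) = 0`; the tree's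
  criterion `isZero_csingularHomology_union_of_mono`).
* `isZero_singularHomology_two_left_of_isConnectedSum` — **`H₂(M # N; ℤ) = 0 ⟹ H₂(M; ℤ) = 0`**
  for 4-manifolds (Kosinski's Mayer–Vietoris step in the degree that matters for homotopy
  4-spheres: `H₂(M ∖ pt) ≅ H₂(range jA) = 0`, then the previous lemma).
* `nonempty_homotopyEquiv_sphere_four_left_of_isConnectedSum_of_iff` — **the named fact at
  universe `0` from the tree's characterisation of homotopy 4-spheres**
  `nonempty_homotopyEquiv_sphere_four_iff.{0}` (`SPC4Wave0.lean`, spc4.S10: `π₁ = 1` and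
  `H₂ = 0`; Freedman–Quinn 1990 §10.1): `M` is simply connected by the proved
  `IsConnectedSum.simplyConnectedSpace_left` (Kosinski's van Kampen step) and has `H₂ = 0` by the
  above.
* `nonempty_homotopyEquiv_sphere_four_left_of_isConnectedSum_of_facts` — the same from the
  textbook named facts behind that characterisation (Poincaré duality `hPD`, Whitehead's
  theorem `hW`, CW type of compact manifolds `hCW`; `HomotopyS4Criterion.lean`).

The statement proved is spelled out (it is, verbatim, the body of the named fact
`nonempty_homotopyEquiv_sphere_four_left_of_isConnectedSum` at universe `0`, whose defining file
`HomotopySphereSummands.lean` is proposed separately; the link by name is a one-line corollary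
once both are in the tree); spaces are in `Type` because the tree's homology comparison maps
relate spaces of one universe. No declaration in this file uses `sorry`; no named fact is
introduced.

## References

* A. Kosinski, *Differential Manifolds*, Academic Press (1993), Ch. VI §2, Prop. 2.1 (p. 91).
  [Kosinski1993]
* A. Hatcher, *Algebraic Topology*, CUP (2002), §2.2 pp. 149–150 (Mayer–Vietoris).
  [HatcherAT2002]
* M. Freedman, F. Quinn, *Topology of 4-manifolds*, PUP (1990), §10.1. [FreedmanQuinnPMS1990]
-/

noncomputable section

-- as in `PuncturedHomotopySphereHomology` / `MayerVietorisCriteria`: chains of the concrete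
-- complex are `Finsupp`s up to unfolding
set_option backward.isDefEq.respectTransparency false

open scoped Manifold ContDiff Topology ContinuousMap
open CategoryTheory Limits Set Function Metric Topology
open Literature.AlgebraicTopology.SingularHomology

namespace Literature.Topology.FourManifolds

/-! ### Mayer–Vietoris on the connected sum: `Hⱼ(P) = 0 ⟹ Hⱼ(range jA) = 0` -/

namespace ConnectedSumNeck

variable {m : ℕ} {M N P : Type} [TopologicalSpace M] [T2Space M] [TopologicalSpace N]
  [T2Space N] [TopologicalSpace P] (d : ConnectedSumNeck (m + 1) M N P)

/-- **`Hⱼ(M # N) = 0` forces `Hⱼ(range jA) = 0`** for `0 < j ≠ m` (dimension `m + 1`): in the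
Mayer–Vietoris sequence of the open cover `P = range jA ∪ range jB` the intersection is the neck
`ℝᵐ⁺¹ ∖ 0 ≃ Sᵐ`, whose `Hⱼ` vanishes, so `Hⱼ(range jA) ⊕ Hⱼ(range jB)` injects into
`Hⱼ(P) = 0` (Kosinski 1993, VI §2, the Mayer–Vietoris computation of `H(M₁ # M₂)`; Hatcher 2002,
§2.2). [cite: Kosinski1993, Ch. VI §2 (p. 91)] -/
theorem isZero_csingularHomology_range_jA {j : ℕ} (hj : j ≠ 0) (hjm : j ≠ m)
    (hP : IsZero (singularHomology ℤ ℤ P j)) :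
    IsZero (csingularHomology ℤ ℤ ↥(range d.jA) j) := by
  -- `range jA ∪ range jB = univ ≃ₜ P`
  let eU : ↥(range d.jA ∪ range d.jB) ≃ₜ P :=
    (Homeomorph.setCongr d.union_range).trans (Homeomorph.Set.univ P)
  have hU : IsZero (csingularHomology ℤ ℤ ↥(range d.jA ∪ range d.jB) j) :=
    (hP.of_iso (csingularHomology.compIso ℤ ℤ P j)).of_iso (csingularHomology.mapIso ℤ ℤ eU j)
  -- the neck `range jA ∩ range jB ≃ₜ ℝᵐ⁺¹ ∖ 0 ≃ₕ Sᵐ`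
  let eI : ↥(range d.jA ∩ range d.jB) ≃ₕ (Metric.sphere (0 : EuclideanSpace ℝ (Fin (m + 1))) 1) :=
    d.neckHomeomorph.symm.toHomotopyEquiv.trans (complZeroHomotopyEquivSphere m)
  have hI : IsZero (csingularHomology ℤ ℤ ↥(range d.jA ∩ range d.jB) j) :=
    (isZero_singularHomology_sphere_holds ℤ ℤ hj hjm).of_iso
      (csingularHomology.isoOfHomotopyEquiv ℤ ℤ eI j ≪≫ csingularHomology.compIso ℤ ℤ _ j)
  exact isZero_csingularHomology_of_union_of_inter ℤ ℤ d.isOpen_range_jA d.isOpen_range_jB j hU hI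

/-- **`Hⱼ(M # N) = 0` forces `Hⱼ(M ∖ {i₁ 0}) = 0`** for `0 < j ≠ m` (dimension `m + 1`): transport
`isZero_csingularHomology_range_jA` along `range jA ≃ₜ M ∖ {i₁ 0}` (`rangeHomeomorphA`).
[cite: Kosinski1993, Ch. VI §2 (p. 91)] -/
theorem isZero_csingularHomology_puncture {j : ℕ} (hj : j ≠ 0) (hjm : j ≠ m)
    (hP : IsZero (singularHomology ℤ ℤ P j)) :
    IsZero (csingularHomology ℤ ℤ ↥(({d.i₁ 0}ᶜ : Set M)) j) :=
  (d.isZero_csingularHomology_range_jA hj hjm hP).of_iso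
    (csingularHomology.mapIso ℤ ℤ d.rangeHomeomorphA j).symm

end ConnectedSumNeck

/-! ### Filling a puncture: `Hⱼ₊₁(M ∖ {p}) = 0 ⟹ Hⱼ₊₁(M) = 0` below the top dimension -/

section Puncture

variable {m : ℕ} {M : Type} [TopologicalSpace M] [T2Space M] [ChartedSpace (EuclideanSpace ℝ (Fin (m + 1))) M]

/-- **Filling a puncture does not create homology below the top dimension**: for a Hausdorff
space `M` charted on `ℝᵐ⁺¹`, a point `p` and `0 < j < m`, if `Hⱼ₊₁(M ∖ {p}) = 0` then
`Hⱼ₊₁(M) = 0`.  Mayer–Vietoris for the open cover `M = (M ∖ {p}) ∪ B` by the punctured space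
and a chart ball `B ∋ p` (`B ≅ ℝᵐ⁺¹` contractible, `(M ∖ {p}) ∩ B ≅ ℝᵐ⁺¹ ∖ 0 ≃ Sᵐ`):
`Hⱼ₊₁(M ∖ {p}) ⊕ Hⱼ₊₁(B) → Hⱼ₊₁(M) → Hⱼ(Sᵐ) = 0` (Hatcher 2002, §2.2 p. 149).
[cite: HatcherAT2002, §2.2 p. 149] -/
theorem isZero_singularHomology_succ_of_isZero_compl_singleton (p : M) {j : ℕ} (hj : j ≠ 0)
    (hjm : j ≠ m)
    (hA : IsZero (csingularHomology ℤ ℤ ↥(({p}ᶜ : Set M)) (j + 1))) :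
    IsZero (singularHomology ℤ ℤ M (j + 1)) := by
  -- the chart ball `B = range i`, `i 0 = p`
  obtain ⟨i, hi, hi0⟩ :=
    Literature.AlgebraicTopology.Homotopy.exists_isOpenEmbedding_apply_zero_eq (E := EuclideanSpace ℝ (Fin (m + 1))) p
  set A : Set M := {p}ᶜ with hAdef
  set B : Set M := range i with hBdef
  have hAo : IsOpen A := isOpen_compl_singleton
  have hBo : IsOpen B := hi.isOpen_range
  have hAB : A ∪ B = univ := by
    refine eq_univ_of_forall fun x => ?_
    by_cases hx : x = p
    · exact Or.inr ⟨0, hi0.trans hx.symm⟩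
    · exact Or.inl hx
  -- `B ≃ₜ ℝᵐ⁺¹` is contractible
  let eB : ↥B ≃ₜ EuclideanSpace ℝ (Fin (m + 1)) := hi.isEmbedding.toHomeomorph.symm
  haveI : ContractibleSpace B := eB.contractibleSpace
  have hB1 : IsZero (csingularHomology ℤ ℤ B (j + 1)) :=
    isZero_csingularHomology_of_contractibleSpace ℤ ℤ (Nat.succ_ne_zero j)
  -- `A ∩ B ≃ₜ ℝᵐ⁺¹ ∖ {0} ≃ₕ Sᵐ`, so `Hⱼ(A ∩ B) = 0`
  let eI₁ : ↥(A ∩ B) ≃ₜ ↥(Subtype.val ⁻¹' A : Set B) :=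
    (Homeomorph.setCongr (inter_comm A B)).trans (preimageValHomeomorph B A).symm
  have heB : ∀ y : B, i (eB y) = (y : M) := fun y => by
    have h1 := congrArg Subtype.val (hi.isEmbedding.toHomeomorph.apply_symm_apply y)
    rwa [Topology.IsEmbedding.toHomeomorph_apply_coe] at h1
  let eI₂ : ↥(Subtype.val ⁻¹' A : Set B) ≃ₜ ↥(({0}ᶜ : Set (EuclideanSpace ℝ (Fin (m + 1))))) :=
    (eB.subtype (p := fun y : B => (y : ↥B) ∈ (Subtype.val ⁻¹' A : Set B))
      (q := fun v : EuclideanSpace ℝ (Fin (m + 1)) => v ∈ (({0}ᶜ : Set (EuclideanSpace ℝ (Fin (m + 1)))))) fun y => by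
        simp only [mem_preimage, hAdef, mem_compl_iff, mem_singleton_iff]
        rw [← heB y, ← hi0]
        exact hi.injective.ne_iff)
  let eI : ↥(A ∩ B) ≃ₕ (Metric.sphere (0 : EuclideanSpace ℝ (Fin (m + 1))) 1) :=
    ((eI₁.trans eI₂).toHomotopyEquiv).trans (complZeroHomotopyEquivSphere m)
  have hI : IsZero (csingularHomology ℤ ℤ ↥(A ∩ B) j) :=
    (isZero_singularHomology_sphere_holds ℤ ℤ hj hjm).of_iso
      (csingularHomology.isoOfHomotopyEquiv ℤ ℤ eI j ≪≫ csingularHomology.compIso ℤ ℤ _ j)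
  -- a map out of a zero object is a monomorphism
  have hm : Mono (csingularHomology.map ℤ ℤ
      (subsetInclusion (inter_subset_left : A ∩ B ⊆ A)) j) :=
    hI.mono _
  -- Mayer–Vietoris, then `A ∪ B = univ ≃ₜ M`
  have hU : IsZero (csingularHomology ℤ ℤ ↥(A ∪ B) (j + 1)) :=
    isZero_csingularHomology_union_of_mono ℤ ℤ hAo hBo j hA hB1 hm
  let eU : ↥(A ∪ B) ≃ₜ M := (Homeomorph.setCongr hAB).trans (Homeomorph.Set.univ M)
  exact hU.of_iso
    ((csingularHomology.compIso ℤ ℤ M (j + 1)).symm ≪≫ (csingularHomology.mapIso ℤ ℤ eU (j + 1)).symm)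

end Puncture

/-! ### `H₂` of the summands of a connected sum of 4-manifolds -/

section FourDim

variable {M N P : Type} [TopologicalSpace M] [T2Space M] [ChartedSpace (EuclideanSpace ℝ (Fin 4)) M]
  [TopologicalSpace N] [T2Space N] [ChartedSpace (EuclideanSpace ℝ (Fin 4)) N] [TopologicalSpace P]
  [ChartedSpace (EuclideanSpace ℝ (Fin 4)) P]

/-- **`H₂(M # N; ℤ) = 0` forces `H₂(M; ℤ) = 0`** (4-manifolds; Kosinski 1993, VI §2: the
Mayer–Vietoris step `H₂(M₁ # M₂) ≅ H₂(M₁) ⊕ H₂(M₂)` in the direction needed for homotopy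
4-spheres).  From the gluing data of `IsConnectedSum`: `H₂(M ∖ {i₁ 0}) ≅ H₂(range jA) = 0`
(`ConnectedSumNeck.isZero_csingularHomology_puncture`), then fill the puncture
(`isZero_singularHomology_succ_of_isZero_compl_singleton`, `H₁(S³) = 0`).
[cite: Kosinski1993, Ch. VI §2 (p. 91)] -/
theorem isZero_singularHomology_two_left_of_isConnectedSum
    (hP : IsConnectedSum (𝓡 4) (𝓡 4) (𝓡 4) M N P)
    (h2 : IsZero (singularHomology ℤ ℤ P 2)) : IsZero (singularHomology ℤ ℤ M 2) := by
  obtain ⟨i₁, i₂, hi₁, hi₂, jA, jB, hjA, hAo, hjB, hBo, hU, hR⟩ := hP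
  let d : ConnectedSumNeck (3 + 1) M N P :=
    { i₁ := i₁
      i₂ := i₂
      jA := jA
      jB := jB
      continuous_i₁ := hi₁.isEmbedding.continuous
      injective_i₁ := hi₁.isEmbedding.injective
      continuous_i₂ := hi₂.isEmbedding.continuous
      injective_i₂ := hi₂.isEmbedding.injective
      isEmbedding_jA := hjA.isEmbedding
      isEmbedding_jB := hjB.isEmbedding
      isOpen_range_jA := hAo
      isOpen_range_jB := hBo
      union_range := hU
      rel := hR }
  have hA : IsZero (csingularHomology ℤ ℤ ↥(({d.i₁ 0}ᶜ : Set M)) (1 + 1)) :=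
    d.isZero_csingularHomology_puncture (j := 1 + 1) (by norm_num) (by norm_num) h2
  exact isZero_singularHomology_succ_of_isZero_compl_singleton (m := 3) (d.i₁ 0) one_ne_zero
    (by norm_num) hA

/-- The symmetric statement: **`H₂(M # N; ℤ) = 0` forces `H₂(N; ℤ) = 0`** (`IsConnectedSum.symm`).
[cite: Kosinski1993, Ch. VI §2 (p. 91)] -/
theorem isZero_singularHomology_two_right_of_isConnectedSum
    (hP : IsConnectedSum (𝓡 4) (𝓡 4) (𝓡 4) M N P)
    (h2 : IsZero (singularHomology ℤ ℤ P 2)) : IsZero (singularHomology ℤ ℤ N 2) :=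
  isZero_singularHomology_two_left_of_isConnectedSum hP.symm h2

end FourDim

/-! ### The named fact at universe `0` from the characterisation of homotopy 4-spheres -/

section Assembly

/-- **A summand of a homotopy 4-sphere is a homotopy 4-sphere, GIVEN the characterisation of
homotopy 4-spheres** `SPC4.nonempty_homotopyEquiv_sphere_four_iff.{0}` (`M ≃ₕ S⁴` iff `π₁ = 1`
and `H₂ = 0`; Freedman–Quinn 1990 §10.1).  This is Kosinski's Prop. VI.2.1 ("only if", `m = 4`)
at universe `0`, i.e. the body of the named fact
`nonempty_homotopyEquiv_sphere_four_left_of_isConnectedSum` (`HomotopySphereSummands.lean`):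
`P ≃ₕ S⁴` is simply connected with `H₂(P) = 0` (proved direction of the characterisation), so
`M` is simply connected (`IsConnectedSum.simplyConnectedSpace_left`, van Kampen) with
`H₂(M) = 0` (`isZero_singularHomology_two_left_of_isConnectedSum`, Mayer–Vietoris), hence a
homotopy 4-sphere. [cite: Kosinski1993, Ch. VI §2, Prop. 2.1] -/
theorem nonempty_homotopyEquiv_sphere_four_left_of_isConnectedSum_of_iff
    (hS10 : nonempty_homotopyEquiv_sphere_four_iff.{0}) :
    ∀ (M : Type) [TopologicalSpace M] [T2Space M] [SecondCountableTopology M]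
      [ChartedSpace (EuclideanSpace ℝ (Fin 4)) M] [IsManifold (𝓡 4) ∞ M] [CompactSpace M] [ConnectedSpace M]
      (N : Type) [TopologicalSpace N] [T2Space N] [SecondCountableTopology N]
      [ChartedSpace (EuclideanSpace ℝ (Fin 4)) N] [IsManifold (𝓡 4) ∞ N] [CompactSpace N] [ConnectedSpace N]
      (P : Type) [TopologicalSpace P] [T2Space P] [SecondCountableTopology P]
      [ChartedSpace (EuclideanSpace ℝ (Fin 4)) P] [IsManifold (𝓡 4) ∞ P],
      IsConnectedSum (𝓡 4) (𝓡 4) (𝓡 4) M N P → P ≃ₕ (Metric.sphere (0 : EuclideanSpace ℝ (Fin 5)) 1) → Nonempty (M ≃ₕ (Metric.sphere (0 : EuclideanSpace ℝ (Fin 5)) 1)) := by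
  intro M _ _ _ _ _ _ _ N _ _ _ _ _ _ _ P _ _ _ _ _ hP e
  obtain ⟨hπP, hP2⟩ := simplyConnectedSpace_and_isZero_of_homotopyEquiv e
  haveI : SimplyConnectedSpace P := hπP
  have h4 : 1 < Module.finrank ℝ (EuclideanSpace ℝ (Fin 4)) := by
    rw [finrank_euclideanSpace_fin]; norm_num
  haveI : SimplyConnectedSpace M := hP.simplyConnectedSpace_left h4
  have hM2 : IsZero (singularHomology ℤ ℤ M 2) :=
    isZero_singularHomology_two_left_of_isConnectedSum hP hP2
  exact (hS10 M).2 ⟨inferInstance, hM2⟩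

/-- **A summand of a homotopy 4-sphere is a homotopy 4-sphere, from the textbook named facts**
(Kosinski 1993, VI Prop. 2.1, "only if", `m = 4`, at universe `0`): Poincaré duality (`hPD`,
Hatcher Thm. 3.30), Whitehead's theorem (`hW`, Cor. 4.33) and the CW homotopy type of compact
manifolds (`hCW`, Cor. A.12) give the characterisation of homotopy 4-spheres
(`nonempty_homotopyEquiv_sphere_four_iff_of_facts`), and
`nonempty_homotopyEquiv_sphere_four_left_of_isConnectedSum_of_iff` applies.
[cite: Kosinski1993, Ch. VI §2, Prop. 2.1] [cite: HatcherAT2002, Thm. 3.30, Cor. 4.33, Cor. A.12] -/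
theorem nonempty_homotopyEquiv_sphere_four_left_of_isConnectedSum_of_facts
    (hPD : ∀ (M : Type) [TopologicalSpace M] [CompactSpace M] [T2Space M] [ChartedSpace (EuclideanSpace ℝ (Fin 4)) M]
      (μ : HomologicalOrientation ℤ M 4), bijective_poincareDualityMap μ (Nat.add_comm 1 3))
    (hW : Literature.AlgebraicTopology.Homotopy.whitehead_exists_homotopyEquiv.{0})
    (hCW : Literature.AlgebraicTopology.Homotopy.exists_cwComplex_homotopyEquiv_of_compactSpace.{0}) :
    ∀ (M : Type) [TopologicalSpace M] [T2Space M] [SecondCountableTopology M]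
      [ChartedSpace (EuclideanSpace ℝ (Fin 4)) M] [IsManifold (𝓡 4) ∞ M] [CompactSpace M] [ConnectedSpace M]
      (N : Type) [TopologicalSpace N] [T2Space N] [SecondCountableTopology N]
      [ChartedSpace (EuclideanSpace ℝ (Fin 4)) N] [IsManifold (𝓡 4) ∞ N] [CompactSpace N] [ConnectedSpace N]
      (P : Type) [TopologicalSpace P] [T2Space P] [SecondCountableTopology P]
      [ChartedSpace (EuclideanSpace ℝ (Fin 4)) P] [IsManifold (𝓡 4) ∞ P],
      IsConnectedSum (𝓡 4) (𝓡 4) (𝓡 4) M N P → P ≃ₕ (Metric.sphere (0 : EuclideanSpace ℝ (Fin 5)) 1) → Nonempty (M ≃ₕ (Metric.sphere (0 : EuclideanSpace ℝ (Fin 5)) 1)) :=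
  nonempty_homotopyEquiv_sphere_four_left_of_isConnectedSum_of_iff
    (nonempty_homotopyEquiv_sphere_four_iff_of_facts hPD hW hCW)

end Assembly

end Literature.Topology.FourManifolds

end
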